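import Mathlib
import Summits.CriticalPhenomena.PercolationContinuityZ3.Theorems.PercNearOneGluingNoHeavyLowerTailThreeFamilyTriple

/-!
# The cyclic Hall count, unconditionally (`MS3-down` is a theorem)

Helper file for crux `stmt-CriticalPhenomena-4575` (`NoHeavyLowerTail`, route `PercNearOneGluingNoHeavy`),
new-inequality factory seat `prim-ineq-gen-3` (gen 9).  Everything here is PROVED.

From `ThreeFamilyRank.triple0` (TRIPLE-0: three functions supported on three families with equal moments on
`G(S;P,Q,R)` are equal) we get `TRIPLE` (`V_P ⊓ V_Q ⊓ V_R = ⊥` when no set lies in all three families), hence by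
Theorem A′ (`ThreeFamilyRank.card_add_card_add_card_le`, p223892) the three-family Marica–Schönheim inequality
`MS3-down`: `#P + #Q + #R ≤ #G(S;P,Q,R)` for pairwise intersecting families with no common member
(`ThreeFamilyRank.card_le_card_downFamily`), and finally the capacity-one Hall count for cyclic selections
`OrientedAntipodalHall.card_le_card_goods_above_cyclic_holds` — `card_le_card_goods_above_cyclic` (gen 5, p204040)
with its hypothesis `hMS3` discharged, i.e. Conjecture O(cyclic) of the LOC-P₂ programme
(memo `run/shared/lean/prim/prim-ineq-gen-3/PROOF-TRIPLE0.md`, MS3-STATE.md §1, §8; prim-ineq-gen-3 gen 9, 2026-08-20).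
-/

namespace Summit.CriticalPhenomena.PercolationContinuityZ3.Theorems

namespace ThreeFamilyRank

open Finset Module
open scoped FinsetFamily

variable {α : Type*} [DecidableEq α]

/-- Moments of a function supported on a family `P` of subsets of `S` are sums over `P`. -/
theorem mom_eq_sum (S : Finset α) {P : Finset (Finset α)} (hPS : ∀ U ∈ P, U ⊆ S) (κ : Finset α → ℚ)
    (hκ : ∀ U, U ∉ P → κ U = 0) (E : Finset α) :
    mom S κ E = ∑ U ∈ P, if E ⊆ U then κ U else 0 := by
  unfold mom
  symm
  apply Finset.sum_subset
  · intro U hU; exact Finset.mem_powerset.mpr (hPS U hU)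
  · intro U _ hUP
    simp [hκ U hUP]

/-- **TRIPLE.**  For three families of subsets of `S` with no common member, the spans of their plain vectors in
`ℚ^{G(S;P,Q,R)}` have trivial triple intersection. -/
theorem V_inf_V_inf_V_eq_bot (S : Finset α) (P Q R : Finset (Finset α))
    (hPS : ∀ U ∈ P, U ⊆ S) (hQS : ∀ U ∈ Q, U ⊆ S) (hRS : ∀ U ∈ R, U ⊆ S)
    (hcommon : ∀ U ∈ P, U ∈ Q → U ∉ R) :
    V (downFamily S P Q R) P ⊓ V (downFamily S P Q R) Q ⊓ V (downFamily S P Q R) R = ⊥ := by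
  rw [Submodule.eq_bot_iff]
  intro v hv
  rw [Submodule.mem_inf, Submodule.mem_inf] at hv
  obtain ⟨⟨hvP, hvQ⟩, hvR⟩ := hv
  -- coefficients of `v` in each family
  have hrep : ∀ (T : Finset (Finset α)), (∀ U ∈ T, U ⊆ S) → v ∈ V (downFamily S P Q R) T →
      ∃ κ : Finset α → ℚ, (∀ U, U ∉ T → κ U = 0) ∧
        ∀ E : ↥(downFamily S P Q R), v E = mom S κ (E : Finset α) := by
    intro T hTS hvT
    rw [V, Submodule.mem_span_range_iff_exists_fun] at hvT
    obtain ⟨c, hc⟩ := hvT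
    refine ⟨fun U => if h : U ∈ T then c ⟨U, h⟩ else 0, fun U hU => by simp [hU], fun E => ?_⟩
    rw [← hc, mom_eq_sum S hTS _ (fun U hU => by simp [hU])]
    rw [Finset.sum_apply]
    simp only [Pi.smul_apply, smul_eq_mul, chi]
    rw [← Finset.sum_coe_sort T (fun U => if (E : Finset α) ⊆ U then
        (if h : U ∈ T then c ⟨U, h⟩ else 0) else 0)]
    refine Finset.sum_congr rfl fun i _ => ?_
    have hi : (i : Finset α) ∈ T := i.2
    by_cases hE : (E : Finset α) ⊆ (i : Finset α) <;> simp [hE, hi]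
  obtain ⟨κP, sP, hP⟩ := hrep P hPS hvP
  obtain ⟨κQ, sQ, hQ⟩ := hrep Q hQS hvQ
  obtain ⟨κR, sR, hR⟩ := hrep R hRS hvR
  have hmom : ∀ E ∈ downFamily S P Q R, mom S κP E = mom S κQ E ∧ mom S κQ E = mom S κR E := by
    intro E hE
    have e1 := hP ⟨E, hE⟩; have e2 := hQ ⟨E, hE⟩; have e3 := hR ⟨E, hE⟩
    exact ⟨e1.symm.trans e2, e2.symm.trans e3⟩
  obtain ⟨hPQ, hQR⟩ := triple0 S P Q R κP κQ κR hPS hQS hRS sP sQ sR hmom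
  -- all coefficients vanish
  have hzero : ∀ U, κP U = 0 := by
    intro U
    by_cases h1 : U ∈ P
    · by_cases h2 : U ∈ Q
      · have h3 : U ∉ R := hcommon U h1 h2
        rw [hPQ, hQR]; exact sR U h3
      · rw [hPQ]; exact sQ U h2
    · exact sP U h1
  funext E
  rw [hP E, mom]
  simp [hzero]

/-- **`MS3-down`, unconditional form.**  Three families of subsets of `S`, pairwise intersecting members (across and
within families) and no common member: `#P + #Q + #R ≤ #G(S; P, Q, R)`. -/
theorem card_le_card_downFamily (S : Finset α) (P Q R : Finset (Finset α))
    (hS : ∀ U ∈ P ∪ Q ∪ R, U ⊆ S)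
    (hint : ∀ U ∈ P ∪ Q ∪ R, ∀ U' ∈ P ∪ Q ∪ R, (U ∩ U').Nonempty)
    (hcommon : ∀ U ∈ P, U ∈ Q → U ∉ R) :
    #P + #Q + #R ≤ #(downFamily S P Q R) :=
  card_le_card_downFamily_of_triple S P Q R hS hint
    (V_inf_V_inf_V_eq_bot S P Q R (fun U hU => hS U (by simp [hU])) (fun U hU => hS U (by simp [hU]))
      (fun U hU => hS U (by simp [hU])) hcommon)

end ThreeFamilyRank

namespace OrientedAntipodalHall

open Finset AntipodalStrongHarris AntipodalStrongHarris.Lab ThreeFamilyRank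

variable {α : Type*} [DecidableEq α] {k : ℕ}

/-- **The capacity-one Hall count for cyclic selections — unconditional.**  For a monotone `Lab`-labeling of the
subsets of `S` and three families `D₁, D₂, D₃` of antipodal bads of the cyclic types `(i,j), (j,l), (l,i)`, at least
`#D₁ + #D₂ + #D₃` good sets `U ⊆ S` (`f U = top`, `f (S \ U) = bot`) contain a member of `D₁ ∪ D₂ ∪ D₃`.
(`card_le_card_goods_above_cyclic` of gen 5 with its hypothesis `hMS3` discharged: `MS3-down` holds by
`ThreeFamilyRank.triple0` + Theorem A′.) -/
theorem card_le_card_goods_above_cyclic_holds (S : Finset α) {f : Finset α → Lab k}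
    (hf : ∀ ⦃X Y : Finset α⦄, X ⊆ Y → f X ≤ f Y) (D₁ D₂ D₃ : Finset (Finset α)) {i j l : Fin k}
    (hij : i ≠ j) (hjl : j ≠ l) (hil : i ≠ l)
    (h₁S : ∀ X ∈ D₁, X ⊆ S) (h₁i : ∀ X ∈ D₁, f X = petal i) (h₁j : ∀ X ∈ D₁, f (S \ X) = petal j)
    (h₂S : ∀ X ∈ D₂, X ⊆ S) (h₂j : ∀ X ∈ D₂, f X = petal j) (h₂l : ∀ X ∈ D₂, f (S \ X) = petal l)
    (h₃S : ∀ X ∈ D₃, X ⊆ S) (h₃l : ∀ X ∈ D₃, f X = petal l) (h₃i : ∀ X ∈ D₃, f (S \ X) = petal i) :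
    #D₁ + #D₂ + #D₃ ≤
      #{U ∈ S.powerset | f U = top ∧ f (S \ U) = bot ∧ ∃ X ∈ D₁ ∪ D₂ ∪ D₃, X ⊆ U} :=
  card_le_card_goods_above_cyclic_of_triple S hf D₁ D₂ D₃ hij hjl hil h₁S h₁i h₁j h₂S h₂j h₂l h₃S h₃l h₃i
    (fun P Q R h1 _ _ h4 _ _ =>
      V_inf_V_inf_V_eq_bot S P Q R (fun U hU => h1 U (by simp [hU])) (fun U hU => h1 U (by simp [hU]))
        (fun U hU => h1 U (by simp [hU]))
        (fun U hUP hUQ _ => (h4 U hUP U hUQ).1 subset_rfl))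

end OrientedAntipodalHall

end Summit.CriticalPhenomena.PercolationContinuityZ3.Theorems
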